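import Literature.NumberTheory.EllipticCurves.BrandtModuleJLSelfPairing
import Literature.NumberTheory.Automorphic.BrandtXiSetupIndependence
import Literature.NumberTheory.Automorphic.BrandtSetupAdmissible
import HarnessLib

/-!
# `ξ(E; N⁺, N⁻)` is the `ξ` of every Brandt setup of type `(N⁺, N⁻)`

Topic `NumberTheory/EllipticCurves`; theorems only (no definition, no named fact, no instance).
Consequences for the elliptic-curve self-pairing `BrandtModuleJLSelfPairing W N⁺ N⁻`
(`= brandtXi N⁺ N⁻ (a_n(E))`, `BrandtModuleJLSelfPairing.lean`) of the canonicity of `ξ(N⁺, N⁻)`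
(`Brandt.XiSetup.brandtXi_eq_xi`, `BrandtXiSetupIndependence.lean`) and of the characterisation of the
admissible levels (`BrandtSetupAdmissible.lean`):

* `brandtModuleJLSelfPairing_eq_xi_setup` — `ξ(E; N⁺, N⁻) = S.xi (a(E))` for EVERY setup `S`
  (not only the one chosen inside `brandtXi`), `= xiOfOrder S.O (N⁺N⁻) (a(E))`;
* `exists_brandtModuleJLSelfPairing_eq_of_squarefree_mul` — under the standing hypotheses of
  Pollack–Weston 2011 Thm. 6.8 / `PollackWeston2011.thm_6_8_ellipticCurve` (`N⁺N⁻ ≠ 0` squarefree,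
  `ω(N⁻)` odd) the value is a genuine `ξ`, computed on any Eichler order of level `N⁺` in any
  definite quaternion algebra of discriminant `N⁻`.

So statements about `brandtXi` / `BrandtModuleJLSelfPairing` (Pollack–Weston) and statements
quantified over all setups (Takahashi, `takahashi2001_thm_2_3`) concern the same number.

## References

* R. Pollack, T. Weston, Compos. Math. 147 (2011), §2.1 and Thm. 6.8 [PollackWeston2011].
* S. Takahashi, J. Number Theory 90 (2001), Thm. 2.3 [Takahashi2001].
-/

noncomputable section

namespace Literature.NumberTheory.EllipticCurves

open Literature.NumberTheory.Automorphic

variable (W : WeierstrassCurve ℚ) {Nplus Nminus : ℕ}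

/-- **`ξ(E; N⁺, N⁻)` is the `ξ` of every setup of type `(N⁺, N⁻)`.** [cite: PollackWeston2011, §2.1] -/
theorem brandtModuleJLSelfPairing_eq_xi_setup (S : Brandt.XiSetup Nplus Nminus) :
    BrandtModuleJLSelfPairing W Nplus Nminus = S.xi fun n => W.LFunction n :=
  S.brandtXi_eq_xi _

/-- `ξ(E; N⁺, N⁻) = xiOfOrder O (N⁺N⁻) (a(E))` for the Eichler order `O` of ANY setup of type
`(N⁺, N⁻)`. [cite: PollackWeston2011, §2.1] -/
theorem brandtModuleJLSelfPairing_eq_xiOfOrder (S : Brandt.XiSetup Nplus Nminus) :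
    BrandtModuleJLSelfPairing W Nplus Nminus =
      Brandt.xiOfOrder S.O (Nplus * Nminus) fun n => W.LFunction n :=
  brandtModuleJLSelfPairing_eq_xi_setup W S

/-- **Under the standing hypotheses of Pollack–Weston Thm. 6.8** (`N = N⁺N⁻ ≠ 0` squarefree,
`ω(N⁻)` odd) **`ξ(E; N⁺, N⁻)` is a genuine `ξ`**: a setup exists and the value is its `ξ`.
[cite: PollackWeston2011, § Notation and §2.1] -/
theorem exists_brandtModuleJLSelfPairing_eq_of_squarefree_mul [NeZero (Nplus * Nminus)]
    (hsq : Squarefree (Nplus * Nminus)) (hodd : Odd Nminus.primeFactors.card) :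
    ∃ S : Brandt.XiSetup Nplus Nminus,
      BrandtModuleJLSelfPairing W Nplus Nminus = S.xi fun n => W.LFunction n := by
  obtain ⟨S⟩ := Brandt.nonempty_xiSetup_of_squarefree_mul (Nplus := Nplus) (Nminus := Nminus) hsq hodd
  exact ⟨S, brandtModuleJLSelfPairing_eq_xi_setup W S⟩

end Literature.NumberTheory.EllipticCurves

end
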